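import Summits.CriticalPhenomena.PercolationContinuityZ3.Theorems.PercNearOneGluingNoHeavyLowerTailSunflowerMultiPetalBottomSpectatorOrder
import HarnessLib
import HarnessLib.Audit

/-!
# `NoHeavyLowerTail` (crux stmt-CriticalPhenomena-4575), abstract sunflower cubic, `k` petals: the bottom-spectator functional under the
# attachment of a TRIANGLE MODULE — `13·QKW A ≤ QKW (A ∪ {a,b,c})` — hence Lemma B and ★ₖ are preserved under adding disjoint triangles

Support file (seat `prim-l12-p2` gen 36; `--supports stmt-CriticalPhenomena-4575`; companion of `…SunflowerMultiPetalBottomSpectator` (p379785) and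
`…SunflowerMultiPetalBottomSpectatorOrder` (`QKW_le_three_of_upper`, `QKW_le_three_of_completing`, `nested_congr_of_subset`)).  No `sorry`; nothing about the crux.
Memo: run/shared/lean/prim/prim-l12/prim-l12-p2/FINDING-g36-BOTTOM-SPECTATOR.md §6 (the UNION THEOREM for the cascade cone; this file is its first Lean instance).

SETTING.  Three points `a, b, c ∉ A` form a TRIANGLE MODULE over the window `A` of the structure `F` if: each of them alone is inert on `A`
(`lab (insert v X) = lab X` for `X ⊆ A`), each pair is a non-bottom set (`lab {a,b} ≠ 0`, …), and the triple completes every `X ⊆ A` into the kernel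
(`lab (X ∪ {a,b,c}) = ⊤`).  For the coloured clutter of a graph this says: `{a,b,c}` spans a triangle and no edge joins it to `A` (a disjoint `K₃` component,
or more generally a triangle attached to `A` only through vertices outside the window).

THEOREM (`MSunflower.QKW_triangle_module`, this work): then `13·QKW A ≤ QKW (insert a (insert b (insert c A)))`.  PROOF: split the sub-cube functional at the
three points (27 nested sums over `A`); the 6 terms with one point per block equal `QKW A` (inertness); the 18 terms with a pair in one block and the third
point elsewhere equal, after removing the single point, twice the three 'pair in block j' terms, whose sum over `j` is `≥ QKW A` by the termwise rule at a
non-bottom offset (`QKW_le_three_of_upper`); the 3 terms with the whole triangle in one block sum to `≥ QKW A` by the termwise rule at a completing offset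
(`QKW_le_three_of_completing`): `6 + 2·3 + 1 = 13`.  This is the case `H = K₃` (`c_H = 13`) of the memo's union theorem `Q(G ⊔ H) ≥ c_H · Q(G)`; in particular
`0 ≤ QKW A ⟹ 0 ≤ QKW (A ∪ triangle)`: Lemma B — hence ★ₖ — is preserved under adding disjoint triangles, a case covered by none of the one-point rules
(the third vertex of a triangle is neither inert, nor pendant, nor a non-bottom singleton, nor petal-completing).
-/

namespace Summit.CriticalPhenomena.PercolationContinuityZ3.Theorems.SunflowerPartition

open Finset

variable {α : Type*} [DecidableEq α]

namespace MSunflower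

variable {k : ℕ} (F : MSunflower k α)

/-- **TRIANGLE MODULE** (this work): if `a, b, c ∉ A` are pairwise distinct, each alone inert on `A`, each pair a non-bottom set, and the triple
completes every `X ⊆ A` into the kernel, then `13·QKW A ≤ QKW (insert a (insert b (insert c A)))`. [this work] -/
theorem QKW_triangle_module (A : Finset α) (a b c : α) (haA : a ∉ A) (hbA : b ∉ A) (hcA : c ∉ A) (hab : a ≠ b) (hac : a ≠ c) (hbc : b ≠ c)
    (hina : ∀ X : Finset α, X ⊆ A → F.lab (insert a X) = F.lab X) (hinb : ∀ X : Finset α, X ⊆ A → F.lab (insert b X) = F.lab X)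
    (hinc : ∀ X : Finset α, X ⊆ A → F.lab (insert c X) = F.lab X)
    (hpab : F.lab (insert a {b}) ≠ 0) (hpac : F.lab (insert a {c}) ≠ 0) (hpbc : F.lab (insert b {c}) ≠ 0)
    (htop : ∀ X : Finset α, X ⊆ A → F.lab (insert a (insert b (insert c X))) = Fin.last (k + 1)) :
    13 * F.QKW A ≤ F.QKW (insert a (insert b (insert c A))) := by
  have hc' : c ∉ A := hcA
  have hb' : b ∉ insert c A := by
    rw [mem_insert]; rintro (h | h); exact hbc h; exact hbA h
  have ha' : a ∉ insert b (insert c A) := by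
    rw [mem_insert, mem_insert]; rintro (h | h | h); exact hab h; exact hac h; exact haA h
  -- the three rule applications
  have hsub2 : ∀ (p q : α) (X : Finset α), insert p ({q} : Finset α) ⊆ insert p (insert q X) :=
    fun p q X => insert_subset_insert p (singleton_subset_iff.2 (mem_insert_self q X))
  have hPab := F.QKW_le_three_of_upper A (fun X => insert a (insert b X)) (F.lab (insert a {b})) hpab
    (fun X _ => F.lab_mono ((subset_insert b X).trans (subset_insert a _))) (fun X _ => F.lab_eq_or_top_of_subset hpab (hsub2 a b X))
  have hPac := F.QKW_le_three_of_upper A (fun X => insert a (insert c X)) (F.lab (insert a {c})) hpac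
    (fun X _ => F.lab_mono ((subset_insert c X).trans (subset_insert a _))) (fun X _ => F.lab_eq_or_top_of_subset hpac (hsub2 a c X))
  have hPbc := F.QKW_le_three_of_upper A (fun X => insert b (insert c X)) (F.lab (insert b {c})) hpbc
    (fun X _ => F.lab_mono ((subset_insert c X).trans (subset_insert b _))) (fun X _ => F.lab_eq_or_top_of_subset hpbc (hsub2 b c X))
  have hTop := F.QKW_le_three_of_completing A (fun X => insert a (insert b (insert c X))) (fun X hX => Or.inr (htop X hX))
  beta_reduce at hPab hPac hPbc hTop
  -- the 6 + 18 congruences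
  have p1 : nested A (fun X S T => qK k (F.lab (insert a (insert b X))) (F.lab (insert c S)) (F.lab T))
      = nested A (fun X S T => qK k (F.lab (insert a (insert b X))) (F.lab S) (F.lab T)) :=
    nested_congr_of_subset A _ _ fun X S T hX hS hT => by rw [hinc S hS]
  have p2 : nested A (fun X S T => qK k (F.lab (insert a (insert b X))) (F.lab S) (F.lab (insert c T)))
      = nested A (fun X S T => qK k (F.lab (insert a (insert b X))) (F.lab S) (F.lab T)) :=
    nested_congr_of_subset A _ _ fun X S T hX hS hT => by rw [hinc T hT]
  have p3 : nested A (fun X S T => qK k (F.lab (insert a (insert c X))) (F.lab (insert b S)) (F.lab T))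
      = nested A (fun X S T => qK k (F.lab (insert a (insert c X))) (F.lab S) (F.lab T)) :=
    nested_congr_of_subset A _ _ fun X S T hX hS hT => by rw [hinb S hS]
  have p4 : nested A (fun X S T => qK k (F.lab (insert a X)) (F.lab (insert b (insert c S))) (F.lab T))
      = nested A (fun X S T => qK k (F.lab X) (F.lab (insert b (insert c S))) (F.lab T)) :=
    nested_congr_of_subset A _ _ fun X S T hX hS hT => by rw [hina X hX]
  have e1 : nested A (fun X S T => qK k (F.lab (insert a X)) (F.lab (insert b S)) (F.lab (insert c T))) = F.QKW A :=
    nested_congr_of_subset A _ _ fun X S T hX hS hT => by rw [hina X hX, hinb S hS, hinc T hT]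
  have p5 : nested A (fun X S T => qK k (F.lab (insert a (insert c X))) (F.lab S) (F.lab (insert b T)))
      = nested A (fun X S T => qK k (F.lab (insert a (insert c X))) (F.lab S) (F.lab T)) :=
    nested_congr_of_subset A _ _ fun X S T hX hS hT => by rw [hinb T hT]
  have e2 : nested A (fun X S T => qK k (F.lab (insert a X)) (F.lab (insert c S)) (F.lab (insert b T))) = F.QKW A :=
    nested_congr_of_subset A _ _ fun X S T hX hS hT => by rw [hina X hX, hinc S hS, hinb T hT]
  have p6 : nested A (fun X S T => qK k (F.lab (insert a X)) (F.lab S) (F.lab (insert b (insert c T))))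
      = nested A (fun X S T => qK k (F.lab X) (F.lab S) (F.lab (insert b (insert c T)))) :=
    nested_congr_of_subset A _ _ fun X S T hX hS hT => by rw [hina X hX]
  have p7 : nested A (fun X S T => qK k (F.lab (insert b (insert c X))) (F.lab (insert a S)) (F.lab T))
      = nested A (fun X S T => qK k (F.lab (insert b (insert c X))) (F.lab S) (F.lab T)) :=
    nested_congr_of_subset A _ _ fun X S T hX hS hT => by rw [hina S hS]
  have p8 : nested A (fun X S T => qK k (F.lab (insert b X)) (F.lab (insert a (insert c S))) (F.lab T))
      = nested A (fun X S T => qK k (F.lab X) (F.lab (insert a (insert c S))) (F.lab T)) :=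
    nested_congr_of_subset A _ _ fun X S T hX hS hT => by rw [hinb X hX]
  have e3 : nested A (fun X S T => qK k (F.lab (insert b X)) (F.lab (insert a S)) (F.lab (insert c T))) = F.QKW A :=
    nested_congr_of_subset A _ _ fun X S T hX hS hT => by rw [hinb X hX, hina S hS, hinc T hT]
  have p9 : nested A (fun X S T => qK k (F.lab (insert c X)) (F.lab (insert a (insert b S))) (F.lab T))
      = nested A (fun X S T => qK k (F.lab X) (F.lab (insert a (insert b S))) (F.lab T)) :=
    nested_congr_of_subset A _ _ fun X S T hX hS hT => by rw [hinc X hX]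
  have p10 : nested A (fun X S T => qK k (F.lab X) (F.lab (insert a (insert b S))) (F.lab (insert c T)))
      = nested A (fun X S T => qK k (F.lab X) (F.lab (insert a (insert b S))) (F.lab T)) :=
    nested_congr_of_subset A _ _ fun X S T hX hS hT => by rw [hinc T hT]
  have e4 : nested A (fun X S T => qK k (F.lab (insert c X)) (F.lab (insert a S)) (F.lab (insert b T))) = F.QKW A :=
    nested_congr_of_subset A _ _ fun X S T hX hS hT => by rw [hinc X hX, hina S hS, hinb T hT]
  have p11 : nested A (fun X S T => qK k (F.lab X) (F.lab (insert a (insert c S))) (F.lab (insert b T)))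
      = nested A (fun X S T => qK k (F.lab X) (F.lab (insert a (insert c S))) (F.lab T)) :=
    nested_congr_of_subset A _ _ fun X S T hX hS hT => by rw [hinb T hT]
  have p12 : nested A (fun X S T => qK k (F.lab X) (F.lab (insert a S)) (F.lab (insert b (insert c T))))
      = nested A (fun X S T => qK k (F.lab X) (F.lab S) (F.lab (insert b (insert c T)))) :=
    nested_congr_of_subset A _ _ fun X S T hX hS hT => by rw [hina S hS]
  have p13 : nested A (fun X S T => qK k (F.lab (insert b (insert c X))) (F.lab S) (F.lab (insert a T)))
      = nested A (fun X S T => qK k (F.lab (insert b (insert c X))) (F.lab S) (F.lab T)) :=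
    nested_congr_of_subset A _ _ fun X S T hX hS hT => by rw [hina T hT]
  have e5 : nested A (fun X S T => qK k (F.lab (insert b X)) (F.lab (insert c S)) (F.lab (insert a T))) = F.QKW A :=
    nested_congr_of_subset A _ _ fun X S T hX hS hT => by rw [hinb X hX, hinc S hS, hina T hT]
  have p14 : nested A (fun X S T => qK k (F.lab (insert b X)) (F.lab S) (F.lab (insert a (insert c T))))
      = nested A (fun X S T => qK k (F.lab X) (F.lab S) (F.lab (insert a (insert c T)))) :=
    nested_congr_of_subset A _ _ fun X S T hX hS hT => by rw [hinb X hX]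
  have e6 : nested A (fun X S T => qK k (F.lab (insert c X)) (F.lab (insert b S)) (F.lab (insert a T))) = F.QKW A :=
    nested_congr_of_subset A _ _ fun X S T hX hS hT => by rw [hinc X hX, hinb S hS, hina T hT]
  have p15 : nested A (fun X S T => qK k (F.lab X) (F.lab (insert b (insert c S))) (F.lab (insert a T)))
      = nested A (fun X S T => qK k (F.lab X) (F.lab (insert b (insert c S))) (F.lab T)) :=
    nested_congr_of_subset A _ _ fun X S T hX hS hT => by rw [hina T hT]
  have p16 : nested A (fun X S T => qK k (F.lab X) (F.lab (insert b S)) (F.lab (insert a (insert c T))))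
      = nested A (fun X S T => qK k (F.lab X) (F.lab S) (F.lab (insert a (insert c T)))) :=
    nested_congr_of_subset A _ _ fun X S T hX hS hT => by rw [hinb S hS]
  have p17 : nested A (fun X S T => qK k (F.lab (insert c X)) (F.lab S) (F.lab (insert a (insert b T))))
      = nested A (fun X S T => qK k (F.lab X) (F.lab S) (F.lab (insert a (insert b T)))) :=
    nested_congr_of_subset A _ _ fun X S T hX hS hT => by rw [hinc X hX]
  have p18 : nested A (fun X S T => qK k (F.lab X) (F.lab (insert c S)) (F.lab (insert a (insert b T))))
      = nested A (fun X S T => qK k (F.lab X) (F.lab S) (F.lab (insert a (insert b T)))) :=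
    nested_congr_of_subset A _ _ fun X S T hX hS hT => by rw [hinc S hS]
  -- split at a, b, c and collect
  show 13 * F.QKW A ≤ nested (insert a (insert b (insert c A))) (fun X Y Z => qK k (F.lab X) (F.lab Y) (F.lab Z))
  rw [nested_insert_split _ a ha']
  rw [nested_insert_split _ b hb', nested_insert_split _ b hb', nested_insert_split _ b hb']
  rw [nested_insert_split _ c hc', nested_insert_split _ c hc', nested_insert_split _ c hc', nested_insert_split _ c hc',
    nested_insert_split _ c hc', nested_insert_split _ c hc', nested_insert_split _ c hc', nested_insert_split _ c hc',
    nested_insert_split _ c hc']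
  linarith [e1, e2, e3, e4, e5, e6, p1, p2, p3, p4, p5, p6, p7, p8, p9, p10, p11, p12, p13, p14, p15, p16, p17, p18]

/-- **Lemma B is preserved under a triangle module** (this work): `0 ≤ QKW A ⟹ 0 ≤ QKW (A ∪ {a,b,c})`. [this work] -/
theorem QKW_nonneg_triangle_module (A : Finset α) (a b c : α) (haA : a ∉ A) (hbA : b ∉ A) (hcA : c ∉ A) (hab : a ≠ b) (hac : a ≠ c)
    (hbc : b ≠ c) (hina : ∀ X : Finset α, X ⊆ A → F.lab (insert a X) = F.lab X) (hinb : ∀ X : Finset α, X ⊆ A → F.lab (insert b X) = F.lab X)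
    (hinc : ∀ X : Finset α, X ⊆ A → F.lab (insert c X) = F.lab X)
    (hpab : F.lab (insert a {b}) ≠ 0) (hpac : F.lab (insert a {c}) ≠ 0) (hpbc : F.lab (insert b {c}) ≠ 0)
    (htop : ∀ X : Finset α, X ⊆ A → F.lab (insert a (insert b (insert c X))) = Fin.last (k + 1)) (hA : 0 ≤ F.QKW A) :
    0 ≤ F.QKW (insert a (insert b (insert c A))) :=
  le_trans (by linarith) (F.QKW_triangle_module A a b c haA hbA hcA hab hac hbc hina hinb hinc hpab hpac hpbc htop)

end MSunflower

end Summit.CriticalPhenomena.PercolationContinuityZ3.Theorems.SunflowerPartition
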